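import Literature.AnabelianGeometry.AbsoluteAnabelian.AbsTopII.DehnTwistLoopProp13ii
import Literature.AnabelianGeometry.AbsoluteAnabelian.AbsTopII.DPSCIndexDataOfEmbeddingCuspCyclic
import HarnessLib

/-!
# [AbsTopII] Prop 1.3 (i) at the NODAL model: the cusp group `Π_c = ⟨[a,b]⟩^ ≅ Ẑ^Σ`

S. Mochizuki, *Topics in Absolute Anabelian Geometry II* [AbsTopII] (bib `MochizukiAbsTopII2013`; locators =
PDF pages of the kurims manuscript `paper:url-585b8d0ad0d9`), §1, Prop 1.3 (i) p. 11: "If `e` is a cusp of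
`𝔾`, then, as abstract profinite groups, `I_e ≅ Ẑ^Σ`."

PROOF-ONLY assembly (no definition), abc-iut-L4-t6 lineage, row «DPSC-NODAL-MODEL»: at the nodal Dehn-twist
datum `dpsc i hi` (`DehnTwistLoopDatum`), the one cusp has `I_c = Π_c × 1 = ⟨aba⁻¹b⁻¹⟩^ × 1 ⊆ F̂₂ ⋊ Ẑ`;
abc-iut-f-069's `isFreeProSigmaCyclic_closure_zpowers_commutator` (`DehnTwistFreeGroupInputs`: `⟨[a,b]⟩^ = c^Ẑ
≅ Ẑ`) and abc-iut-f-069's generic transport `DPSCIndexData.prop_1_3_i_ofEmbedding` (closed subgroups of the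
compact `Π_𝒢` map isomorphically into `Π_H`) give the typed `Prop_1_3_i` with no hypothesis; bundled with
(ii)/(ii′)/(iii, first clause) of `DehnTwistLoopProp13ii`.  HONEST FRAMING: classical profinite group theory in a
constructed model (constructed ≠ geometric); typed ≠ proved for the paper's geometric statement; nothing here
bears on [IUTchIII] Cor 3.12.
-/

noncomputable section

namespace Literature.AnabelianGeometry.AbsoluteAnabelian.AbsTopII.DehnTwist

open Literature.AnabelianGeometry.EtaleTheta.SettingModel

/-- **[AbsTopII] Prop 1.3 (i) — the typed `Prop_1_3_i` ("`I_e ≅ Ẑ^Σ` for every cusp `e`") — HOLDS at the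
nodal Dehn-twist datum `dpsc i hi`, with no hypothesis** (`Σ` = all primes; the cusp group is
`⟨aba⁻¹b⁻¹⟩^ × 1 ≅ c^Ẑ ≅ Ẑ`). [cite: MochizukiAbsTopII2013, Prop 1.3 (i) p.11] -/
theorem prop_1_3_i_dpsc_holds {i : ℕ} (hi : 0 < i) :
    Literature.AnabelianGeometry.AbsoluteAnabelian.AbsTopII.DPSCIndexData.Prop_1_3_i (dpsc i hi) :=
  Literature.AnabelianGeometry.AbsoluteAnabelian.AbsTopII.DPSCIndexData.prop_1_3_i_ofEmbedding loopDatum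
    (extGrp i) (SemidirectProduct.inl : F₂hatT →* Ext i) (continuous_inl i) SemidirectProduct.inl_injective
    (isClosed_range_inl i) (normal_range_inl i) ⊤ inferInstance le_top (fun _ => i)
    (fun _ => ⟨hi, fun _ hp _ => hp⟩) (fun _ => isFreeProSigmaCyclic_closure_zpowers_commutator)

/-- **A DPSC datum WITH A NODE at which Prop 1.3 (i), (ii) (both typings) and the first clause of (iii) all
hold, non-idly and with no hypothesis, EXISTS** (`Σ` = all primes; node index any `i ≥ 1`).
[cite: MochizukiAbsTopII2013, Prop 1.3 (i) p.11] -/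
theorem exists_nodal_model_prop_1_3_i_ii_iii (i : ℕ) (hi : 0 < i) :
    ∃ X : DPSCIndexData.{0}, Nonempty X.Node ∧ Nonempty X.Cusp ∧ X.Sigma = {p | p.Prime} ∧
      (∀ e : X.Node, X.sigmaIndex e = i) ∧
      Literature.AnabelianGeometry.AbsoluteAnabelian.AbsTopII.DPSCIndexData.Prop_1_3_i X ∧
      Literature.AnabelianGeometry.AbsoluteAnabelian.AbsTopII.DPSCIndexData.Prop_1_3_ii' X ∧
      Literature.AnabelianGeometry.AbsoluteAnabelian.AbsTopII.DPSCIndexData.Prop_1_3_ii X ∧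
      X.toDPSCData.Prop13iii :=
  ⟨dpsc i hi, dpsc_node_nonempty i hi, ⟨⟨()⟩⟩, rfl, fun _ => rfl, prop_1_3_i_dpsc_holds hi,
    prop_1_3_ii'_dpsc_holds hi, prop_1_3_ii_dpsc_holds hi, prop13iii_dpsc_holds hi⟩

end Literature.AnabelianGeometry.AbsoluteAnabelian.AbsTopII.DehnTwist

end
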